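import Summits.ABC.ABC.Theorems.TwistAmplificationMazurKaneLawShapeLevelLift
import Summits.ABC.ABC.Theorems.TwistAmplificationMazurKaneLawSliceClassBound
import Summits.ABC.ABC.Theorems.TwistAmplificationMazurKaneLawSliceReduction
import Summits.ABC.ABC.Theorems.TwistAmplificationMazurKaneLawSlices
import Literature.NumberTheory.DiophantineGeometry.AbcExceptionalSetBoundsProofs

/-!
# The reach of the lever `LevelTorsorBound` (line `peyre-level-torsor-v22`, crux stmt-ABC-2757)

Kernel-checked composition of the LANDED stubs of the line (lead prover-line-stmt-ABC-2757-0, 2026-08-16):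
`ShapeLevelLift` (B), `SliceClassBound` (C1), `SliceReduction` (C2) and the slice assembly of
`TwistAmplificationMazurKaneLawSlices`, giving — from the single remaining hypothesis `LevelTorsorBound` (the lever:
Le Boudec's level-aspect torsor count on `V₂² : x₀y₀² + x₁y₁² + x₂y₂² = 0` at `d = 2`, max-form) —

* `MazurKaneLaw.leverSliceBound_of_levelTorsorBound`: the two-regime bound for EVERY radical slice
  `#{c ≤ N, c^{s-η} < rad(abc) ≤ c^s} ≤ C N^{max(s-1,(3-s)/2)+ε}` (`1 < s < 2`, window `η(ε)` uniform in `s`),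
  in particular the Mazur–Kane slice law `SliceLawHigh` on `[5/3, 2)` (`MazurKaneLaw.sliceLawHigh_of_levelTorsorBound`);
* `LeverReach` (registered name): the Mazur–Kane law itself, `#{c ≤ N, rad(abc) ≤ c^s} ≤ C N^{s-1+ε}`, for every
  `s ∈ [13/7, 2)` — the honest reach of the lever ALONE: floor at `x₀ = 9/7` by the PROVED trivial bound
  `bernertEtAl2024_prop_1_1` (`N_λ(X) ≪ X^{2λ/3+ε}`; `2·(9/7)/3 = 6/7 = 13/7 - 1`), slices above `9/7` by the
  two-regime bound (`max(x-1,(3-x)/2) ≤ s - 1` for `9/7 < x ≤ s`, `s ≥ 13/7`).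

So the open part of the line near `s = 2` is exactly ONE statement, `LevelTorsorBound`; but see
`TwistAmplificationMazurKaneLawLeverPell` (`LeverPellBox`): as registered it also contains the upper-bound half of
Hooley's conjecture on fundamental units (all exponents `α`), which is why the lead re-scoped the registered
high-range stub to the slice law `SliceLawHigh`.
-/

namespace Summit.ABC.ABC.Theorems

open Literature.NumberTheory.DiophantineGeometry
open Literature.NumberTheory.DiophantineGeometry.AbcShapes

/-- **Lever ⟹ two-regime slice bound.** `LevelTorsorBound` gives, for every `ε > 0`, a window `η > 0` such that
for all `1 < s < 2`: `#{c ≤ N, c^{s-η} < rad(abc) ≤ c^s} ≤ C N^{max(s-1,(3-s)/2)+ε}` (`N ≥ 2`). Composition of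
the landed `ShapeLevelLift`, `SliceClassBound`, `SliceReduction` with `card_classRange_le`: shape parameter
`ε₁ = min(ε/20, 1/4)`, window `η = min(ε/4, 1)`, class-count slack `ε/4`. [folklore] -/
theorem MazurKaneLaw.leverSliceBound_of_levelTorsorBound
    (hLever : ∀ ε : ℝ, 0 < ε → ∃ K : ℝ, ∀ (f₁ f₂ f₃ : ℕ) (X Y Z : Fin 2 → ℕ), 0 < f₁ → 0 < f₂ → 0 < f₃ →
      (∀ i, 0 < X i) → (∀ i, 0 < Y i) → (∀ i, 0 < Z i) →
        (shapeCount f₁ f₂ f₃ X Y Z : ℝ) ≤ K * ((f₃ : ℝ) * ((shapeVal Z : ℕ) : ℝ)) ^ ε *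
          (1 + ((X 0 : ℝ) * X 1 * Y 0 * Y 1 * Z 0 * Z 1) / ((f₃ : ℝ) * ((shapeVal Z : ℕ) : ℝ)))) :
    ∀ ε : ℝ, 0 < ε → ∃ η : ℝ, 0 < η ∧ ∀ s : ℝ, 1 < s → s < 2 → ∃ C : ℝ, ∀ N : ℕ, 2 ≤ N →
      (Set.ncard {t : ℕ × ℕ × ℕ | IsABCTriple t.1 t.2.1 t.2.2 ∧ t.2.2 ≤ N ∧
          (t.2.2 : ℝ) ^ (s - η) < ((rad t.1 t.2.1 t.2.2 : ℕ) : ℝ) ∧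
          ((rad t.1 t.2.1 t.2.2 : ℕ) : ℝ) ≤ (t.2.2 : ℝ) ^ s} : ℝ) ≤
        C * (N : ℝ) ^ (max (s - 1) ((3 - s) / 2) + ε) := by
  have hSLB := ShapeLevelLift hLever
  intro ε hε
  obtain ⟨ε₁, hε₁⟩ : ∃ t : ℝ, t = min (ε / 20) (1 / 4) := ⟨_, rfl⟩
  obtain ⟨η, hη⟩ : ∃ t : ℝ, t = min (ε / 4) 1 := ⟨_, rfl⟩
  have hε₁0 : 0 < ε₁ := by rw [hε₁]; exact lt_min (by positivity) (by norm_num)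
  have hε₁4 : ε₁ ≤ 1 / 4 := by rw [hε₁]; exact min_le_right _ _
  have hε₁ε : ε₁ ≤ ε / 20 := by rw [hε₁]; exact min_le_left _ _
  have hη0 : 0 < η := by rw [hη]; exact lt_min (by positivity) one_pos
  have hηε : η ≤ ε / 4 := by rw [hη]; exact min_le_left _ _
  have hη1 : η ≤ 1 := by rw [hη]; exact min_le_right _ _
  refine ⟨η, hη0, fun s hs1 hs2 => ?_⟩
  obtain ⟨K, hK0, hK⟩ := SliceClassBound hSLB s hs1 hs2 ε₁ hε₁0 hε₁4 η hη0
  have hmax0 : 0 ≤ max (s - 1) ((3 - s) / 2) := le_max_of_le_left (by linarith)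
  have hθ0 : 0 ≤ max (s - 1) ((3 - s) / 2) + 5 * ε₁ + η := by linarith
  have hred := SliceReduction s hs1 hs2 ε₁ hε₁0 hε₁4 η hη0 (by linarith) _ K hθ0 hK0 hK
  obtain ⟨C, hC0, hC⟩ := card_classRange_le ε₁ (δ := ε / 4) (by positivity)
  refine ⟨K * C, fun N hN => ?_⟩
  have hN1 : (1 : ℝ) ≤ N := by exact_mod_cast (by omega : 1 ≤ N)
  have hN0 : (0 : ℝ) < N := by positivity
  have hexp : (N : ℝ) ^ (3 * ε₁ / 2 + ε / 4) * (N : ℝ) ^ (max (s - 1) ((3 - s) / 2) + 5 * ε₁ + η) ≤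
      (N : ℝ) ^ (max (s - 1) ((3 - s) / 2) + ε) := by
    rw [← Real.rpow_add hN0]
    exact Real.rpow_le_rpow_of_exponent_le hN1 (by linarith)
  calc (Set.ncard {t : ℕ × ℕ × ℕ | IsABCTriple t.1 t.2.1 t.2.2 ∧ t.2.2 ≤ N ∧
          (t.2.2 : ℝ) ^ (s - η) < ((rad t.1 t.2.1 t.2.2 : ℕ) : ℝ) ∧
          ((rad t.1 t.2.1 t.2.2 : ℕ) : ℝ) ≤ (t.2.2 : ℝ) ^ s} : ℝ)
        ≤ K * (classRange ε₁ N).card * (N : ℝ) ^ (max (s - 1) ((3 - s) / 2) + 5 * ε₁ + η) := hred N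
    _ ≤ K * (C * (N : ℝ) ^ (3 * ε₁ / 2 + ε / 4)) * (N : ℝ) ^ (max (s - 1) ((3 - s) / 2) + 5 * ε₁ + η) :=
        mul_le_mul_of_nonneg_right (mul_le_mul_of_nonneg_left (hC N hN) hK0) (by positivity)
    _ = K * C * ((N : ℝ) ^ (3 * ε₁ / 2 + ε / 4) * (N : ℝ) ^ (max (s - 1) ((3 - s) / 2) + 5 * ε₁ + η)) := by
        ring
    _ ≤ K * C * (N : ℝ) ^ (max (s - 1) ((3 - s) / 2) + ε) :=
        mul_le_mul_of_nonneg_left hexp (mul_nonneg hK0 hC0.le)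

/-- **Lever ⟹ the slice law on `[5/3, 2)`** (`SliceLawHigh` of the skeleton, verbatim): there
`max(s-1, (3-s)/2) = s - 1`. [folklore] -/
theorem MazurKaneLaw.sliceLawHigh_of_levelTorsorBound
    (hLever : ∀ ε : ℝ, 0 < ε → ∃ K : ℝ, ∀ (f₁ f₂ f₃ : ℕ) (X Y Z : Fin 2 → ℕ), 0 < f₁ → 0 < f₂ → 0 < f₃ →
      (∀ i, 0 < X i) → (∀ i, 0 < Y i) → (∀ i, 0 < Z i) →
        (shapeCount f₁ f₂ f₃ X Y Z : ℝ) ≤ K * ((f₃ : ℝ) * ((shapeVal Z : ℕ) : ℝ)) ^ ε *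
          (1 + ((X 0 : ℝ) * X 1 * Y 0 * Y 1 * Z 0 * Z 1) / ((f₃ : ℝ) * ((shapeVal Z : ℕ) : ℝ)))) :
    ∀ ε : ℝ, 0 < ε → ∃ η : ℝ, 0 < η ∧ ∀ s : ℝ, 5 / 3 ≤ s → s < 2 → ∃ C : ℝ, ∀ N : ℕ, 2 ≤ N →
      (Set.ncard {t : ℕ × ℕ × ℕ | IsABCTriple t.1 t.2.1 t.2.2 ∧ t.2.2 ≤ N ∧
          (t.2.2 : ℝ) ^ (s - η) < ((rad t.1 t.2.1 t.2.2 : ℕ) : ℝ) ∧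
          ((rad t.1 t.2.1 t.2.2 : ℕ) : ℝ) ≤ (t.2.2 : ℝ) ^ s} : ℝ) ≤ C * (N : ℝ) ^ (s - 1 + ε) := by
  intro ε hε
  obtain ⟨η, hη, hs⟩ := MazurKaneLaw.leverSliceBound_of_levelTorsorBound hLever ε hε
  refine ⟨η, hη, fun s hs53 hs2 => ?_⟩
  obtain ⟨C, hC⟩ := hs s (by linarith) hs2
  refine ⟨C, fun N hN => ?_⟩
  have hmax : max (s - 1) ((3 - s) / 2) = s - 1 := max_eq_left (by linarith)
  have h1 := hC N hN
  rw [hmax] at h1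
  exact h1

/-- **The reach of the lever alone** (registered name `LeverReach`): `LevelTorsorBound` implies the Mazur–Kane law
`#{abc : c ≤ N, rad(abc) ≤ c^s} ≤ C N^{s-1+ε}` for every `s ∈ [13/7, 2)` and every `ε > 0` — no foreign stub.
Floor at `x₀ = 9/7`: the cumulative count at `9/7` lies in `abcExponentCount (9/7 + ε/2) N ≪ N^{6/7 + 5ε/6}`
(`bernertEtAl2024_prop_1_1`, proved in the tree); slices of the lever's window `η` above `9/7` are
`≪ N^{max(x-1,(3-x)/2)+ε} ≤ N^{s-1+ε}` for `9/7 < x ≤ s` since `s ≥ 13/7`; assembled by `MazurKaneLaw.assemble`.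
[folklore] -/
theorem LeverReach : (∀ ε : ℝ, 0 < ε → ∃ K : ℝ, ∀ (f₁ f₂ f₃ : ℕ) (X Y Z : Fin 2 → ℕ), 0 < f₁ → 0 < f₂ → 0 < f₃ → (∀ i, 0 < X i) → (∀ i, 0 < Y i) → (∀ i, 0 < Z i) → (Literature.NumberTheory.DiophantineGeometry.AbcShapes.shapeCount f₁ f₂ f₃ X Y Z : ℝ) ≤ K * ((f₃ : ℝ) * ((Literature.NumberTheory.DiophantineGeometry.AbcShapes.shapeVal Z : ℕ) : ℝ)) ^ ε * (1 + ((X 0 : ℝ) * X 1 * Y 0 * Y 1 * Z 0 * Z 1) / ((f₃ : ℝ) * ((Literature.NumberTheory.DiophantineGeometry.AbcShapes.shapeVal Z : ℕ) : ℝ)))) → ∀ s : ℝ, 13 / 7 ≤ s → s < 2 → ∀ ε : ℝ, 0 < ε → ∃ C : ℝ, ∀ N : ℕ, 2 ≤ N → (Set.ncard {t : ℕ × ℕ × ℕ | Literature.NumberTheory.DiophantineGeometry.IsABCTriple t.1 t.2.1 t.2.2 ∧ t.2.2 ≤ N ∧ ((Literature.NumberTheory.DiophantineGeometry.rad t.1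 t.2.1 t.2.2 : ℕ) : ℝ) ≤ (t.2.2 : ℝ) ^ s} : ℝ) ≤ C * (N : ℝ) ^ (s - 1 + ε) := by
  intro hLever s hs1 hs2 ε hε
  obtain ⟨η, hη0, hS⟩ := MazurKaneLaw.leverSliceBound_of_levelTorsorBound hLever ε hε
  -- the floor: the trivial bound at level `9/7 + ε/2`
  obtain ⟨C₀, hC₀⟩ := bernertEtAl2024_prop_1_1 (l := 9 / 7 + ε / 2) (by linarith) (half_pos hε)
  choose! Cf hCf using hS
  obtain ⟨J, hJ⟩ : ∃ J : ℕ, s - J * η ≤ 9 / 7 := MazurKaneLaw.exists_steps hη0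
  refine ⟨max C₀ 0 + ∑ j ∈ Finset.range J, max (Cf (s - j * η)) 0, fun N hN => ?_⟩
  have hN1 : (1 : ℝ) ≤ N := by exact_mod_cast (show 1 ≤ N by omega)
  have hN0 : (0 : ℝ) ≤ N := by linarith
  have hpow : ∀ {p q : ℝ}, p ≤ q → (N : ℝ) ^ p ≤ (N : ℝ) ^ q := fun h =>
    Real.rpow_le_rpow_of_exponent_le hN1 h
  refine MazurKaneLaw.assemble (x₀ := 9 / 7) (xmax := s) (P := (N : ℝ) ^ (s - 1 + ε)) (C₀ := max C₀ 0)
    (m := fun x => (Set.ncard {t : ℕ × ℕ × ℕ | IsABCTriple t.1 t.2.1 t.2.2 ∧ t.2.2 ≤ N ∧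
        ((rad t.1 t.2.1 t.2.2 : ℕ) : ℝ) ≤ (t.2.2 : ℝ) ^ x} : ℝ))
    (sl := fun x => (Set.ncard {t : ℕ × ℕ × ℕ | IsABCTriple t.1 t.2.1 t.2.2 ∧ t.2.2 ≤ N ∧
        (t.2.2 : ℝ) ^ (x - η) < ((rad t.1 t.2.1 t.2.2 : ℕ) : ℝ) ∧
        ((rad t.1 t.2.1 t.2.2 : ℕ) : ℝ) ≤ (t.2.2 : ℝ) ^ x} : ℝ))
    hη0 (Real.rpow_nonneg hN0 _) (fun x y hxy => MazurKaneLaw.ncard_cumulative_mono N hxy)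
    (fun x => MazurKaneLaw.ncard_cumulative_peel N x η) ?_ (fun x => max (Cf x) 0)
    (fun x => le_max_right _ _) ?_ J s le_rfl hJ
  · -- floor: `{rad ≤ c^{9/7}} ⊆ {rad < c^{9/7+ε/2}}` (as `c ≥ 2`), then Prop. 1.1
    have hsub : {t : ℕ × ℕ × ℕ | IsABCTriple t.1 t.2.1 t.2.2 ∧ t.2.2 ≤ N ∧
        ((rad t.1 t.2.1 t.2.2 : ℕ) : ℝ) ≤ (t.2.2 : ℝ) ^ (9 / 7 : ℝ)} ⊆
        {t : ℕ × ℕ × ℕ | IsABCTriple t.1 t.2.1 t.2.2 ∧ t.2.2 ≤ N ∧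
          ((rad t.1 t.2.1 t.2.2 : ℕ) : ℝ) < (t.2.2 : ℝ) ^ (9 / 7 + ε / 2)} := by
      rintro t ⟨ht, hN', hle⟩
      refine ⟨ht, hN', hle.trans_lt ?_⟩
      have h2 : (1 : ℝ) < (t.2.2 : ℝ) := by
        obtain ⟨ha, hb, habc, -⟩ := ht
        have : 2 ≤ t.2.2 := by omega
        exact_mod_cast this
      exact Real.rpow_lt_rpow_of_exponent_lt h2 (by linarith)
    have h1 : (Set.ncard {t : ℕ × ℕ × ℕ | IsABCTriple t.1 t.2.1 t.2.2 ∧ t.2.2 ≤ N ∧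
        ((rad t.1 t.2.1 t.2.2 : ℕ) : ℝ) ≤ (t.2.2 : ℝ) ^ (9 / 7 : ℝ)} : ℝ) ≤
        (abcExponentCount (9 / 7 + ε / 2) N : ℝ) := by
      rw [abcExponentCount]
      exact_mod_cast Set.ncard_le_ncard hsub (abcExponentCount_finite _ N)
    calc (Set.ncard {t : ℕ × ℕ × ℕ | IsABCTriple t.1 t.2.1 t.2.2 ∧ t.2.2 ≤ N ∧
            ((rad t.1 t.2.1 t.2.2 : ℕ) : ℝ) ≤ (t.2.2 : ℝ) ^ (9 / 7 : ℝ)} : ℝ)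
          ≤ C₀ * (N : ℝ) ^ (2 * (9 / 7 + ε / 2) / 3 + ε / 2) := h1.trans (hC₀ N hN)
      _ ≤ max C₀ 0 * (N : ℝ) ^ (2 * (9 / 7 + ε / 2) / 3 + ε / 2) :=
          mul_le_mul_of_nonneg_right (le_max_left _ _) (Real.rpow_nonneg hN0 _)
      _ ≤ max C₀ 0 * (N : ℝ) ^ (s - 1 + ε) :=
          mul_le_mul_of_nonneg_left (hpow (by linarith)) (le_max_right _ _)
  · -- slices above `9/7`
    intro x hx1 hxs
    have h := (hCf x (by linarith) (by linarith)) N hN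
    have hm : max (x - 1) ((3 - x) / 2) + ε ≤ s - 1 + ε :=
      add_le_add (max_le (by linarith) (by linarith)) le_rfl
    calc (Set.ncard {t : ℕ × ℕ × ℕ | IsABCTriple t.1 t.2.1 t.2.2 ∧ t.2.2 ≤ N ∧
            (t.2.2 : ℝ) ^ (x - η) < ((rad t.1 t.2.1 t.2.2 : ℕ) : ℝ) ∧
            ((rad t.1 t.2.1 t.2.2 : ℕ) : ℝ) ≤ (t.2.2 : ℝ) ^ x} : ℝ)
          ≤ Cf x * (N : ℝ) ^ (max (x - 1) ((3 - x) / 2) + ε) := h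
      _ ≤ max (Cf x) 0 * (N : ℝ) ^ (max (x - 1) ((3 - x) / 2) + ε) :=
          mul_le_mul_of_nonneg_right (le_max_left _ _) (Real.rpow_nonneg hN0 _)
      _ ≤ max (Cf x) 0 * (N : ℝ) ^ (s - 1 + ε) :=
          mul_le_mul_of_nonneg_left (hpow hm) (le_max_right _ _)

end Summit.ABC.ABC.Theorems
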